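import Mathlib
import HarnessLib
import Summits.Ventures.LatticeQCDFlow.Scoring.GaussianShiftedBallThreshold
import Summits.Ventures.LatticeQCDFlow.Scoring.SimultaneousAgreementTwoSigma

/-!
# HOW FAST THE `k`-ARM TEST LOSES ITS NOMINAL LEVEL UNDER DRIFTS, QUANTITATIVELY: THE SHIFTED-BALL
# PROBABILITY IS `φ(0)`-LIPSCHITZ IN THE NON-CENTRALITY, `F_c(0) − κ/√(2π) ≤ F_c(κ)`, AND BEYOND
# `√c` IT IS BELOW THE MILLS TAIL `φ(κ − √c)/(κ − √c)`

HONEST FRAMING: exact (Metropolis-corrected) sampling algorithms for lattice gauge theory;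
figures of merit are autocorrelation/cost numbers at stated couplings and volumes; no
continuum-physics claim.

Venture `LatticeQCDFlow` (cell pub-lqcd), topic `Scoring`; FANOUT row 4 (`s0-u1-b`, GEN-35).
NEW WORK of the cell (classical; our formalisation), no definition, nothing cited as a fact
(mean value theorem, Mills' ratio NAMED ONLY).

WHY (row 4).  `Scoring/KArmHomogeneityLocalPower` identifies the limiting acceptance probability of
the one-shot `k`-arm test under drifts with the shifted-ball probability `F_c(κ)`,
`κ² = Σ_r (h_r − h̄_w)²/s_r`; `Scoring/GaussianShiftedBallThreshold` shows `F_c` is continuous and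
strictly decreasing with a unique detectable `κ_β` for every target `β`, but gives no SIZE.  This
file gives the two value-free quantitative envelopes that bracket `κ_β` without any table:
(i) ROBUSTNESS — the one-dimensional window `δ ↦ N(δ,1)([−z,z])` has derivative
`φ(−z−δ) − φ(z−δ)` (that file), which is bounded by `φ(0) = 1/√(2π)` in absolute value, so it is
`φ(0)`-Lipschitz (**`lipschitzWith_gaussianReal_real_Icc_symm`**); integrating the sections of
`Scoring/GaussianShiftedBallThreshold.pi_gaussianReal_shiftedBall_eq_integral`, so is `F_c`
(**`pi_gaussianReal_shiftedBall_lipschitz`**): a non-centrality `κ` lowers the limiting acceptance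
probability by AT MOST `κ·φ(0)` (**`pi_gaussianReal_shiftedBall_ge_null_sub`**), hence every
detectable effect size satisfies `κ_β ≥ (F_c(0) − β)/φ(0)` (**`detectable_noncentrality_ge`**);
(ii) DETECTION — `F_c(κ) ≤ N(κ,1)([−√c,√c]) ≤ N(0,1)((κ−√c, ∞)) ≤ φ(κ−√c)/(κ−√c)` for `κ > √c`
(**`gaussianReal_real_Icc_symm_le_mills`**, **`pi_gaussianReal_shiftedBall_le_mills`**, Mills' bound
of `Scoring/SimultaneousAgreementTwoSigma`): the test rejects with limiting probability `≥ 1 − β` as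
soon as `κ ≥ √c + m` with `φ(m)/m ≤ β` (**`pi_gaussianReal_shiftedBall_le_of_mills`**).

NOT CLAIMED: the exact `κ_β` (non-central `χ²` quantiles); sharper (Gaussian-isoperimetric) constants.
-/

open MeasureTheory ProbabilityTheory Filter Topology Finset

namespace Summit.Ventures.LatticeQCDFlow.Scoring

open Set

/-! ## §1 The one-dimensional window is `φ(0)`-Lipschitz in its centre -/

section Window

/-- `0 ≤ φ(x) ≤ φ(0)` for the standard normal density. -/
theorem gaussianPDFReal_std_le_zero (x : ℝ) : gaussianPDFReal 0 1 x ≤ gaussianPDFReal 0 1 0 := by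
  rw [CardConsistency.gaussianPDFReal_std_eq, CardConsistency.gaussianPDFReal_std_eq]
  refine mul_le_mul_of_nonneg_left (Real.exp_le_exp.2 ?_) (by positivity)
  have : 0 ≤ x ^ 2 / 2 := by positivity
  simp only [ne_eq, OfNat.ofNat_ne_zero, not_false_eq_true, zero_pow, zero_div, neg_zero]
  linarith

/-- `|φ(a) − φ(b)| ≤ φ(0)`: two values in `[0, φ(0)]`. -/
theorem abs_gaussianPDFReal_std_sub_le (a b : ℝ) :
    |gaussianPDFReal 0 1 a - gaussianPDFReal 0 1 b| ≤ gaussianPDFReal 0 1 0 := by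
  have ha := gaussianPDFReal_std_le_zero a
  have hb := gaussianPDFReal_std_le_zero b
  have ha0 := gaussianPDFReal_nonneg 0 1 a
  have hb0 := gaussianPDFReal_nonneg 0 1 b
  rw [abs_le]
  constructor <;> linarith

/-- **`δ ↦ N(δ,1)([−z, z])` IS `φ(0)`-LIPSCHITZ** (`z ≥ 0`; `φ(0) = 1/√(2π)`). [ours] -/
theorem lipschitzWith_gaussianReal_real_Icc_symm {z : ℝ} (hz : 0 ≤ z) :
    LipschitzWith (gaussianPDFReal 0 1 0).toNNReal (fun δ : ℝ => (gaussianReal δ 1).real (Icc (-z) z)) := by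
  have hderiv := hasDerivAt_gaussianReal_real_Icc_symm hz
  refine lipschitzWith_of_nnnorm_deriv_le (fun δ => (hderiv δ).differentiableAt) fun δ => ?_
  rw [(hderiv δ).deriv, ← NNReal.coe_le_coe, coe_nnnorm, Real.norm_eq_abs,
    Real.coe_toNNReal _ (gaussianPDFReal_nonneg 0 1 0)]
  exact abs_gaussianPDFReal_std_sub_le _ _

/-- Distance form: `|N(δ,1)([−z,z]) − N(δ',1)([−z,z])| ≤ φ(0)·|δ − δ'|` (`z ≥ 0`). [ours] -/
theorem abs_gaussianReal_real_Icc_symm_sub_le {z : ℝ} (hz : 0 ≤ z) (δ δ' : ℝ) :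
    |(gaussianReal δ 1).real (Icc (-z) z) - (gaussianReal δ' 1).real (Icc (-z) z)|
      ≤ gaussianPDFReal 0 1 0 * |δ - δ'| := by
  have h := (lipschitzWith_gaussianReal_real_Icc_symm hz).dist_le_mul δ δ'
  rw [Real.dist_eq, Real.dist_eq, Real.coe_toNNReal _ (gaussianPDFReal_nonneg 0 1 0)] at h
  exact h

/-- **The acceptance deficit of the window under a drift is at most `φ(0)·|δ|`**:
`N(0,1)([−z,z]) − φ(0)|δ| ≤ N(δ,1)([−z,z])` (`z ≥ 0`). [ours] -/
theorem gaussianReal_real_Icc_symm_ge_null_sub {z : ℝ} (hz : 0 ≤ z) (δ : ℝ) :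
    (gaussianReal 0 1).real (Icc (-z) z) - gaussianPDFReal 0 1 0 * |δ|
      ≤ (gaussianReal δ 1).real (Icc (-z) z) := by
  have h := abs_gaussianReal_real_Icc_symm_sub_le hz 0 δ
  rw [zero_sub, abs_neg] at h
  have := (abs_le.1 h).2
  linarith

/-- The one-dimensional section `κ ↦ N(0,1){t | (t+κ)² ≤ ρ}` is `φ(0)`-Lipschitz too (every `ρ`):
it is the window `N(κ,1)([−√ρ, √ρ])` for `ρ ≥ 0` and identically `0` otherwise. [ours] -/
theorem abs_gaussianReal_real_sqShift_sub_le (ρ κ κ' : ℝ) :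
    |(gaussianReal 0 1).real {t : ℝ | (t + κ) ^ 2 ≤ ρ} - (gaussianReal 0 1).real {t : ℝ | (t + κ') ^ 2 ≤ ρ}|
      ≤ gaussianPDFReal 0 1 0 * |κ - κ'| := by
  rw [gaussianReal_real_sqShift_le, gaussianReal_real_sqShift_le]
  split_ifs with hρ
  · exact abs_gaussianReal_real_Icc_symm_sub_le (Real.sqrt_nonneg ρ) κ κ'
  · rw [sub_self, abs_zero]
    exact mul_nonneg (gaussianPDFReal_nonneg 0 1 0) (abs_nonneg _)

/-- **Mills for the shifted window**: for `κ > z`,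
`N(κ,1)([−z, z]) ≤ N(0,1)((κ − z, ∞)) ≤ φ(κ − z)/(κ − z)`. [ours] -/
theorem gaussianReal_real_Icc_symm_le_mills {z κ : ℝ} (hκ : z < κ) :
    (gaussianReal κ 1).real (Icc (-z) z) ≤ gaussianPDFReal 0 1 (κ - z) / (κ - z) := by
  have hpos : 0 < κ - z := by linarith
  rw [CardConsistency.gaussianReal_real_Icc_shift]
  -- `[−z−κ, z−κ] ⊆ (−∞, −(κ−z)]`, and by symmetry `N(0,1)((−∞, −(κ−z))) = N(0,1)((κ−z, ∞))`
  have hsub : Icc (-z - κ) (z - κ) ⊆ Iic (-(κ - z)) := fun t ht => by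
    simp only [Set.mem_Icc] at ht
    simp only [Set.mem_Iic]
    linarith [ht.2]
  have h1 : (gaussianReal 0 1).real (Icc (-z - κ) (z - κ)) ≤ (gaussianReal 0 1).real (Iic (-(κ - z))) :=
    measureReal_mono hsub
  have h2 : (gaussianReal 0 1).real (Iic (-(κ - z))) = (gaussianReal 0 1).real (Iio (-(κ - z))) := by
    haveI := nullSingletonClass_gaussianReal (μ := (0 : ℝ)) one_ne_zero
    exact measureReal_congr Iio_ae_eq_Iic.symm
  rw [h2, CardConsistency.gaussianReal_real_Iio_neg_eq] at h1
  exact h1.trans (CardConsistency.gaussianReal_real_Ioi_le hpos)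

end Window

/-! ## §2 The shifted-ball probability: Lipschitz in `κ`, bracketed above by Mills -/

section Ball

variable {ι : Type*} [Fintype ι] [DecidableEq ι]

/-- **`F_c` IS `φ(0)`-LIPSCHITZ IN THE NON-CENTRALITY**:
`|F_c(κ) − F_c(κ')| ≤ φ(0)·|κ − κ'|` for the shifted-ball probability
`F_c(κ) = N^{⊗ι}{(z_{r₁} + κ)² + Σ_{r≠r₀,r₁} z_r² ≤ c}` (every `c`). [ours] -/
theorem pi_gaussianReal_shiftedBall_lipschitz (r₀ r₁ : ι) (c κ κ' : ℝ) :
    |(Measure.pi fun _ : ι => gaussianReal 0 1).real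
        {z : ι → ℝ | (z r₁ + κ) ^ 2 + ∑ r ∈ (univ.erase r₀).erase r₁, z r ^ 2 ≤ c}
      - (Measure.pi fun _ : ι => gaussianReal 0 1).real
        {z : ι → ℝ | (z r₁ + κ') ^ 2 + ∑ r ∈ (univ.erase r₀).erase r₁, z r ^ 2 ≤ c}|
      ≤ gaussianPDFReal 0 1 0 * |κ - κ'| := by
  rw [pi_gaussianReal_shiftedBall_eq_integral, pi_gaussianReal_shiftedBall_eq_integral]
  set μ := (Measure.pi fun _ : ι => gaussianReal 0 1) with hμ
  set f : ℝ → (ι → ℝ) → ℝ := fun κ x =>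
    (gaussianReal 0 1).real {t : ℝ | (t + κ) ^ 2 ≤ c - ∑ r ∈ (univ.erase r₀).erase r₁, x r ^ 2} with hf
  have hmeas : ∀ κ, Measurable (f κ) := fun κ =>
    measurable_gaussianReal_real_sqShift_comp κ (by fun_prop)
  have hint : ∀ κ, Integrable (f κ) μ := fun κ =>
    (memLp_top_of_bound (hmeas κ).aestronglyMeasurable 1 (Eventually.of_forall fun x => by
      rw [Real.norm_eq_abs, abs_of_nonneg measureReal_nonneg]; exact measureReal_le_one)).integrable le_top
  change |∫ x, f κ x ∂μ - ∫ x, f κ' x ∂μ| ≤ gaussianPDFReal 0 1 0 * |κ - κ'|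
  rw [← integral_sub (hint κ) (hint κ')]
  calc |∫ x, (f κ x - f κ' x) ∂μ| ≤ ∫ x, |f κ x - f κ' x| ∂μ := by
        rw [← Real.norm_eq_abs]
        exact (norm_integral_le_integral_norm _).trans_eq (by simp only [Real.norm_eq_abs])
    _ ≤ ∫ _x, gaussianPDFReal 0 1 0 * |κ - κ'| ∂μ := by
        refine integral_mono_of_nonneg (Eventually.of_forall fun x => abs_nonneg _)
          (integrable_const _) (Eventually.of_forall fun x => ?_)
        exact abs_gaussianReal_real_sqShift_sub_le _ κ κ'
    _ = gaussianPDFReal 0 1 0 * |κ - κ'| := by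
        rw [integral_const, hμ]
        simp

/-- **A NON-CENTRALITY `κ` LOWERS THE LIMITING ACCEPTANCE PROBABILITY BY AT MOST `κ·φ(0)`**:
`F_c(0) − φ(0)·|κ| ≤ F_c(κ)`. [ours] -/
theorem pi_gaussianReal_shiftedBall_ge_null_sub (r₀ r₁ : ι) (c κ : ℝ) :
    (Measure.pi fun _ : ι => gaussianReal 0 1).real
        {z : ι → ℝ | (z r₁ + 0) ^ 2 + ∑ r ∈ (univ.erase r₀).erase r₁, z r ^ 2 ≤ c}
      - gaussianPDFReal 0 1 0 * |κ|
      ≤ (Measure.pi fun _ : ι => gaussianReal 0 1).real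
        {z : ι → ℝ | (z r₁ + κ) ^ 2 + ∑ r ∈ (univ.erase r₀).erase r₁, z r ^ 2 ≤ c} := by
  have h := pi_gaussianReal_shiftedBall_lipschitz r₀ r₁ c 0 κ
  rw [zero_sub, abs_neg] at h
  have := (abs_le.1 h).2
  linarith

/-- **LOWER BOUND ON THE DETECTABLE EFFECT SIZE**: if `F_c(κ) ≤ β` then `κ ≥ (F_c(0) − β)/φ(0)`
(`κ ≥ 0`): the test cannot reach acceptance probability `β` before non-centrality
`√(2π)·(F_c(0) − β)`. [ours] -/
theorem detectable_noncentrality_ge (r₀ r₁ : ι) {c κ β : ℝ} (hκ : 0 ≤ κ)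
    (hβ : (Measure.pi fun _ : ι => gaussianReal 0 1).real
        {z : ι → ℝ | (z r₁ + κ) ^ 2 + ∑ r ∈ (univ.erase r₀).erase r₁, z r ^ 2 ≤ c} ≤ β) :
    ((Measure.pi fun _ : ι => gaussianReal 0 1).real
        {z : ι → ℝ | (z r₁ + 0) ^ 2 + ∑ r ∈ (univ.erase r₀).erase r₁, z r ^ 2 ≤ c} - β)
      / gaussianPDFReal 0 1 0 ≤ κ := by
  have hφ : 0 < gaussianPDFReal 0 1 0 := gaussianPDFReal_pos 0 1 0 one_ne_zero
  have h := pi_gaussianReal_shiftedBall_ge_null_sub r₀ r₁ c κ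
  rw [abs_of_nonneg hκ] at h
  rw [div_le_iff₀ hφ]
  linarith

/-- **MILLS ENVELOPE FOR THE SHIFTED BALL**: `c ≥ 0`, `κ > √c` ⇒ `F_c(κ) ≤ φ(κ − √c)/(κ − √c)`. [ours] -/
theorem pi_gaussianReal_shiftedBall_le_mills (r₀ r₁ : ι) {c κ : ℝ} (hc : 0 ≤ c)
    (hκ : Real.sqrt c < κ) :
    (Measure.pi fun _ : ι => gaussianReal 0 1).real
        {z : ι → ℝ | (z r₁ + κ) ^ 2 + ∑ r ∈ (univ.erase r₀).erase r₁, z r ^ 2 ≤ c}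
      ≤ gaussianPDFReal 0 1 (κ - Real.sqrt c) / (κ - Real.sqrt c) := by
  have h1 := pi_gaussianReal_shiftedBall_le_marginal (ι := ι) r₀ r₁ κ c
  rw [gaussianReal_sqShift_le_eq hc] at h1
  have h1' : (Measure.pi fun _ : ι => gaussianReal 0 1).real
        {z : ι → ℝ | (z r₁ + κ) ^ 2 + ∑ r ∈ (univ.erase r₀).erase r₁, z r ^ 2 ≤ c}
      ≤ (gaussianReal κ 1).real (Icc (-Real.sqrt c) (Real.sqrt c)) := by
    simp only [measureReal_def]
    exact (ENNReal.toReal_le_toReal (measure_ne_top _ _) (measure_ne_top _ _)).2 h1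
  exact h1'.trans (gaussianReal_real_Icc_symm_le_mills hκ)

/-- **DETECTION GUARANTEE**: `c ≥ 0`, `m > 0`, `φ(m)/m ≤ β` and `κ ≥ √c + m` ⇒ `F_c(κ) ≤ β` — the
limiting acceptance probability under any drift configuration with non-centrality at least
`√c + m` is at most `β`. [ours] -/
theorem pi_gaussianReal_shiftedBall_le_of_mills (r₀ r₁ : ι) {c κ m β : ℝ} (hc : 0 ≤ c)
    (hm : 0 < m) (hβ : gaussianPDFReal 0 1 m / m ≤ β) (hκ : Real.sqrt c + m ≤ κ) :
    (Measure.pi fun _ : ι => gaussianReal 0 1).real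
        {z : ι → ℝ | (z r₁ + κ) ^ 2 + ∑ r ∈ (univ.erase r₀).erase r₁, z r ^ 2 ≤ c} ≤ β := by
  -- monotonicity in κ reduces to κ = √c + m, then Mills
  have hκ0 : 0 ≤ Real.sqrt c + m := by positivity
  have hmono := pi_gaussianReal_shiftedBall_antitoneOn (ι := ι) r₀ r₁ c
    (Set.mem_Ici.2 hκ0) (Set.mem_Ici.2 (hκ0.trans hκ)) hκ
  refine hmono.trans ?_
  have h := pi_gaussianReal_shiftedBall_le_mills (ι := ι) r₀ r₁ hc
    (show Real.sqrt c < Real.sqrt c + m by linarith)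
  rw [show Real.sqrt c + m - Real.sqrt c = m by ring] at h
  exact h.trans hβ

end Ball

end Summit.Ventures.LatticeQCDFlow.Scoring
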